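import Mathlib
import HarnessLib
import Summits.Ventures.LatticeQCDFlow.Scaling.U1IdentityFlowVolumeLaw

/-!
# LatticeQCDFlow / Scaling — the untrained 2-d U(1) sampler, IV: STRICTNESS — `ESS < 1 iff the flow
# is imperfect` on a general space, hence `I₀(β)² < I₀(2β)`, `I₀(β/2)² < I₀(β)` and `acc_V → 0`

HONEST FRAMING: exact (Metropolis-corrected) sampling algorithms for lattice gauge theory;
figures of merit are autocorrelation/cost numbers at stated couplings and volumes; no
continuum-physics claim.

Venture `LatticeQCDFlow` (cell pub-lqcd), topic `Scaling`; FANOUT row 3 (`s0-u1-a`, S0-B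
implementation A: the 2-d U(1) flow sampler, GEN-12).  NEW WORK of the cell (elementary, no
numerics).  `Scaling/U1IdentityFlowVolumeLaw` (imported) gave the closed forms
`ESS₁ = I₀(β)²/I₀(2β)`, `BC₁ = I₀(β/2)/√I₀(β)` of the identity flow on one plaquette and the
two-sided geometric law in the number of plaquettes; `Scaling/AcceptanceVolumeDecayPi` (imported
through it) showed `BC < 1 ↔ ¬ p = q a.e.` and `acc_m → 0` for imperfect identical blocks.  Here:

* **`integral_sq_div_eq_one_add`** (general space) — the χ² identity
  `∫ p²/q = 1 + ∫ (p − q)²/q` for normalised `p` and positive normalised `q`, hence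
  `one_le_integral_sq_div` (`ESS ≤ 1`) and **`one_lt_integral_sq_div_iff`** — `∫ p²/q > 1`, i.e.
  `ESS < 1`, iff the flow is NOT perfect (`¬ p = q` a.e.);
* `one_lt_besselI_zero` — `1 < I₀(β)` for `β ≠ 0` (two terms of the power series);
* **`not_u1Wilson_ae_eq_u1Haar`** — for `β ≠ 0` the Wilson density is not a.e. the Haar density
  on `(0, 2π]` (continuity + the value at `θ = π/2`);
* **`sq_besselI_zero_lt`** — `I₀(β)² < I₀(2β)`, and **`sq_besselI_zero_half_lt`** —
  `I₀(β/2)² < I₀(β)`, for every `β ≠ 0`: two strict Bessel inequalities read off the sampler laws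
  (`ESS₁ < 1`, `BC₁ < 1`);
* **`u1IdentityFlow_meanAccept_tendsto_zero`** — for `β ≠ 0` the equilibrium acceptance of the
  untrained exact sampler on `V` independent plaquettes tends to `0` as `V → ∞`, below the
  geometric envelope `(I₀(β/2)²/I₀(β))^V` with ratio `< 1`.

Reading (value-free; no number of ours is computed or implied): at every nonzero coupling the
untrained sampler of the factorised 2-d U(1) model is strictly imperfect per plaquette, so its
effective sample size and acceptance decay to zero geometrically in the volume — the qualitative
content of "training is necessary", now with explicit Bessel ratios.  NOT CLAIMED: the
periodic-torus constraint; rates at the cell's `(β, L)`; nothing re-scored.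
-/

namespace Summit.Ventures.LatticeQCDFlow.Theory2

open MeasureTheory Real Set Finset Filter Topology
open Literature.Analysis.FunctionSpaces (besselI besselI_zero_pos hasSum_besselI)
open Summit.Ventures.LatticeQCDFlow.Scoring (onePlaquetteZ onePlaquetteZ_pos onePlaquetteZ_eq_besselI)

/-! ## General space: `ESS < 1` iff the flow is imperfect -/

section OneSpace

variable {X : Type*} [MeasurableSpace X] {μ : Measure X}

/-- **The χ² identity**: for `∫ p = 1`, `q > 0` with `∫ q = 1` and `p²/q ∈ L¹`,
`∫ p²/q = 1 + ∫ (p − q)²/q`. [folklore] -/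
theorem integral_sq_div_eq_one_add {p q : X → ℝ} (hpi : Integrable p μ) (hp1 : ∫ a, p a ∂μ = 1)
    (hq0 : ∀ a, 0 < q a) (hqi : Integrable q μ) (hq1 : ∫ a, q a ∂μ = 1)
    (hW : Integrable (fun a => p a ^ 2 / q a) μ) :
    ∫ a, p a ^ 2 / q a ∂μ = 1 + ∫ a, (p a - q a) ^ 2 / q a ∂μ := by
  have e : ∀ a, (p a - q a) ^ 2 / q a = p a ^ 2 / q a - 2 * p a + q a := by
    intro a
    have hq := (hq0 a).ne'
    field_simp
    ring
  simp_rw [e]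
  have h2 : Integrable (fun a => 2 * p a) μ := hpi.const_mul 2
  have h1 : Integrable (fun a => p a ^ 2 / q a - 2 * p a) μ := hW.sub h2
  rw [integral_add h1 hqi, integral_sub hW h2, integral_const_mul, hp1, hq1]
  ring

/-- **`ESS ≤ 1`**: `1 ≤ ∫ p²/q`. [folklore] -/
theorem one_le_integral_sq_div {p q : X → ℝ} (hpi : Integrable p μ) (hp1 : ∫ a, p a ∂μ = 1)
    (hq0 : ∀ a, 0 < q a) (hqi : Integrable q μ) (hq1 : ∫ a, q a ∂μ = 1)
    (hW : Integrable (fun a => p a ^ 2 / q a) μ) :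
    1 ≤ ∫ a, p a ^ 2 / q a ∂μ := by
  rw [integral_sq_div_eq_one_add hpi hp1 hq0 hqi hq1 hW]
  have h : 0 ≤ ∫ a, (p a - q a) ^ 2 / q a ∂μ :=
    integral_nonneg fun a => div_nonneg (sq_nonneg _) (hq0 a).le
  linarith

/-- **`ESS < 1` iff the flow is imperfect**: `1 < ∫ p²/q ↔ ¬ p = q` `μ`-a.e. [ours] -/
theorem one_lt_integral_sq_div_iff {p q : X → ℝ} (hpi : Integrable p μ) (hp1 : ∫ a, p a ∂μ = 1)
    (hq0 : ∀ a, 0 < q a) (hqi : Integrable q μ) (hq1 : ∫ a, q a ∂μ = 1)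
    (hW : Integrable (fun a => p a ^ 2 / q a) μ) :
    1 < ∫ a, p a ^ 2 / q a ∂μ ↔ ¬ (p =ᵐ[μ] q) := by
  have e : ∀ a, (p a - q a) ^ 2 / q a = p a ^ 2 / q a - 2 * p a + q a := by
    intro a
    have hq := (hq0 a).ne'
    field_simp
    ring
  have hDi : Integrable (fun a => (p a - q a) ^ 2 / q a) μ := by
    have h2 : Integrable (fun a => 2 * p a) μ := hpi.const_mul 2
    have h : Integrable (fun a => p a ^ 2 / q a - 2 * p a + q a) μ := (hW.sub h2).add hqi
    exact h.congr (Eventually.of_forall fun a => (e a).symm)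
  have hD0 : 0 ≤ ∫ a, (p a - q a) ^ 2 / q a ∂μ :=
    integral_nonneg fun a => div_nonneg (sq_nonneg _) (hq0 a).le
  rw [integral_sq_div_eq_one_add hpi hp1 hq0 hqi hq1 hW, lt_add_iff_pos_right,
    hD0.lt_iff_ne, ne_comm, Ne, integral_eq_zero_iff_of_nonneg
      (fun a => div_nonneg (sq_nonneg _) (hq0 a).le) hDi, not_congr]
  constructor
  · intro h
    filter_upwards [h] with a ha
    have hq := (hq0 a).ne'
    have h0 : (p a - q a) ^ 2 / q a = 0 := ha
    rw [div_eq_zero_iff, pow_eq_zero_iff two_ne_zero, sub_eq_zero] at h0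
    exact h0.resolve_right hq
  · intro h
    filter_upwards [h] with a ha
    show (p a - q a) ^ 2 / q a = 0
    rw [ha, sub_self, zero_pow two_ne_zero, zero_div]

end OneSpace

/-! ## One plaquette: the Wilson density is not the Haar density -/

section OnePlaquette

/-- **`1 < I₀(β)` for `β ≠ 0`** (the first two terms of the power series: `I₀(β) ≥ 1 + β²/4`).
[folklore] -/
theorem one_lt_besselI_zero {β : ℝ} (hβ : β ≠ 0) : 1 < besselI 0 β := by
  have hs := hasSum_besselI 0 β
  have h2 : ∑ k ∈ range 2, (β / 2) ^ (2 * k + 0) / (((Nat.factorial k : ℕ) : ℝ)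
      * ((Nat.factorial (k + 0) : ℕ) : ℝ)) ≤ besselI 0 β :=
    sum_le_hasSum (range 2) (fun k _ => div_nonneg (by rw [add_zero, pow_mul]; positivity)
      (by positivity)) hs
  have e : ∑ k ∈ range 2, (β / 2) ^ (2 * k + 0) / (((Nat.factorial k : ℕ) : ℝ)
      * ((Nat.factorial (k + 0) : ℕ) : ℝ)) = 1 + (β / 2) ^ 2 := by
    simp [sum_range_succ]
  rw [e] at h2
  have hb : 0 < (β / 2) ^ 2 := by positivity
  linarith

/-- The Wilson one-plaquette density is continuous. [folklore] -/
theorem continuous_u1Wilson (β : ℝ) :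
    Continuous fun θ : ℝ => Real.exp (β * Real.cos θ) / onePlaquetteZ β :=
  (Real.continuous_exp.comp (continuous_const.mul Real.continuous_cos)).div_const _

/-- At `θ = π/2` the Wilson density is `1/(2π I₀(β))`, which differs from the Haar density
`1/(2π)` when `β ≠ 0`. [folklore] -/
theorem u1Wilson_half_pi_ne {β : ℝ} (hβ : β ≠ 0) :
    Real.exp (β * Real.cos (π / 2)) / onePlaquetteZ β ≠ 1 / (2 * π) := by
  rw [Real.cos_pi_div_two, mul_zero, Real.exp_zero, onePlaquetteZ_eq_besselI]
  intro h
  have hI := one_lt_besselI_zero hβ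
  have hπ : 0 < 2 * π := by positivity
  have h' : besselI 0 β = 1 := by
    field_simp at h
    nlinarith [h, hπ]
  linarith

/-- **For `β ≠ 0` the Wilson density is NOT almost everywhere the Haar density on `(0, 2π]`**
(continuous functions a.e. equal on `(0, 2π]` agree there; they differ at `π/2`). [ours] -/
theorem not_u1Wilson_ae_eq_u1Haar {β : ℝ} (hβ : β ≠ 0) :
    ¬ ((fun θ : ℝ => Real.exp (β * Real.cos θ) / onePlaquetteZ β)
        =ᵐ[volume.restrict (Ioc (0 : ℝ) (2 * π))] fun _ => (1 / (2 * π) : ℝ)) := by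
  intro h
  have heq := Measure.eqOn_Ioc_of_ae_eq (μ := volume) h (continuous_u1Wilson β).continuousOn
    continuousOn_const
  have hmem : π / 2 ∈ Ioc (0 : ℝ) (2 * π) := ⟨by positivity, by linarith [Real.pi_pos]⟩
  exact u1Wilson_half_pi_ne hβ (heq hmem)

/-- **`I₀(β/2)² < I₀(β)` for `β ≠ 0`** — the identity flow's block affinity is `< 1`
(`BC₁ = I₀(β/2)/√I₀(β) < 1` by `integral_sqrt_mul_lt_one_iff`). [ours] -/
theorem sq_besselI_zero_half_lt {β : ℝ} (hβ : β ≠ 0) : besselI 0 (β / 2) ^ 2 < besselI 0 β := by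
  have h := (integral_sqrt_mul_lt_one_iff (μ := volume.restrict (Ioc (0 : ℝ) (2 * π)))
    (fun θ => (u1Wilson_pos β θ).le) (measurable_u1Wilson β) (integrable_u1Wilson β)
    (integral_u1Wilson β) (fun _ => by positivity) measurable_const integrable_u1Haar
    integral_u1Haar).2 (not_u1Wilson_ae_eq_u1Haar hβ)
  rw [integral_sqrt_u1Wilson_mul] at h
  have hI : 0 < besselI 0 β := besselI_zero_pos β
  have hs : 0 < Real.sqrt (besselI 0 β) := Real.sqrt_pos.2 hI
  have h1 : besselI 0 (β / 2) < Real.sqrt (besselI 0 β) := by rwa [div_lt_one hs] at h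
  have h0 : 0 ≤ besselI 0 (β / 2) := (besselI_zero_pos _).le
  calc besselI 0 (β / 2) ^ 2 < Real.sqrt (besselI 0 β) ^ 2 := by gcongr
    _ = besselI 0 β := Real.sq_sqrt hI.le

/-- **`I₀(β)² < I₀(2β)` for `β ≠ 0`** — the identity flow's block effective sample size is `< 1`
(`ESS₁ = I₀(β)²/I₀(2β) < 1` by `one_lt_integral_sq_div_iff`). [ours] -/
theorem sq_besselI_zero_lt {β : ℝ} (hβ : β ≠ 0) : besselI 0 β ^ 2 < besselI 0 (2 * β) := by
  have hW : Integrable (fun θ : ℝ => (Real.exp (β * Real.cos θ) / onePlaquetteZ β) ^ 2 / (1 / (2 * π)))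
      (volume.restrict (Ioc (0 : ℝ) (2 * π))) := by
    have e : ∀ θ : ℝ, (Real.exp (β * Real.cos θ) / onePlaquetteZ β) ^ 2 / (1 / (2 * π))
        = 2 * π / onePlaquetteZ β ^ 2 * Real.exp (2 * β * Real.cos θ) := by
      intro θ
      rw [div_pow, exp_mul_cos_sq]
      field_simp
    simp_rw [e]
    exact (integrableOn_exp_mul_cos (2 * β)).const_mul _
  have h := (one_lt_integral_sq_div_iff (μ := volume.restrict (Ioc (0 : ℝ) (2 * π)))
    (integrable_u1Wilson β) (integral_u1Wilson β) (fun _ => by positivity) integrable_u1Haar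
    integral_u1Haar hW).2 (not_u1Wilson_ae_eq_u1Haar hβ)
  rw [integral_u1Wilson_sq_div] at h
  have hI : 0 < besselI 0 β := besselI_zero_pos β
  rwa [one_lt_div (by positivity)] at h

/-- **`ESS₁ < 1` and `BC₁² < 1` for `β ≠ 0`**, as ratios. [ours] -/
theorem u1IdentityFlow_ratios_lt_one {β : ℝ} (hβ : β ≠ 0) :
    besselI 0 β ^ 2 / besselI 0 (2 * β) < 1 ∧ besselI 0 (β / 2) ^ 2 / besselI 0 β < 1 :=
  ⟨(div_lt_one (besselI_zero_pos _)).2 (sq_besselI_zero_lt hβ),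
    (div_lt_one (besselI_zero_pos _)).2 (sq_besselI_zero_half_lt hβ)⟩

end OnePlaquette

/-! ## `V → ∞`: the untrained acceptance tends to zero -/

/-- **THE UNTRAINED ACCEPTANCE VANISHES IN THE VOLUME**: for `β ≠ 0`, the equilibrium acceptance
of the exact sampler proposing `V` independent plaquette angles from the Haar prior against the
product Wilson weight is at most `(I₀(β/2)²/I₀(β))^V` with ratio `< 1`, and tends to `0` as
`V → ∞`. [ours] -/
theorem u1IdentityFlow_meanAccept_tendsto_zero {β : ℝ} (hβ : β ≠ 0) :
    besselI 0 (β / 2) ^ 2 / besselI 0 β < 1 ∧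
    (∀ V : ℕ, ∫ x, ∫ x', min ((∏ i : Fin V, Real.exp (β * Real.cos (x i)) / onePlaquetteZ β)
          * ∏ _i : Fin V, (1 / (2 * π) : ℝ))
        ((∏ i : Fin V, Real.exp (β * Real.cos (x' i)) / onePlaquetteZ β)
          * ∏ _i : Fin V, (1 / (2 * π) : ℝ))
        ∂(Measure.pi fun _ : Fin V => volume.restrict (Ioc (0 : ℝ) (2 * π)))
        ∂(Measure.pi fun _ : Fin V => volume.restrict (Ioc (0 : ℝ) (2 * π)))
      ≤ (besselI 0 (β / 2) ^ 2 / besselI 0 β) ^ V) ∧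
    Tendsto (fun V : ℕ => ∫ x, ∫ x',
        min ((∏ i : Fin V, Real.exp (β * Real.cos (x i)) / onePlaquetteZ β)
          * ∏ _i : Fin V, (1 / (2 * π) : ℝ))
        ((∏ i : Fin V, Real.exp (β * Real.cos (x' i)) / onePlaquetteZ β)
          * ∏ _i : Fin V, (1 / (2 * π) : ℝ))
        ∂(Measure.pi fun _ : Fin V => volume.restrict (Ioc (0 : ℝ) (2 * π)))
        ∂(Measure.pi fun _ : Fin V => volume.restrict (Ioc (0 : ℝ) (2 * π)))) atTop (𝓝 0) := by
  have h := tendsto_meanAccept_pi_const_zero (ν := volume.restrict (Ioc (0 : ℝ) (2 * π)))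
    (fun θ => (u1Wilson_pos β θ).le) (measurable_u1Wilson β) (integrable_u1Wilson β)
    (integral_u1Wilson β) (fun _ => by positivity) measurable_const integrable_u1Haar
    integral_u1Haar (not_u1Wilson_ae_eq_u1Haar hβ)
  rw [integral_sqrt_u1Wilson_mul, div_pow, Real.sq_sqrt (besselI_zero_pos β).le] at h
  exact h

end Summit.Ventures.LatticeQCDFlow.Theory2
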